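import Summits.AnomalousDissipation.AnomalousDissipation.Theorems.SolenoidalFractalHomogenisationLagrangianStepZAssembly
import Summits.AnomalousDissipation.AnomalousDissipation.Theorems.SolenoidalFractalHomogenisationLagrangianStepWindowPropagatorL
import Literature.Analysis.FluidPDE.PassiveVectorTensorModeEnergy
import Literature.Analysis.FunctionSpaces.TorusHNegOnePairing
import HarnessLib

/-!
# K1L_D (stmt-AnomalousDissipation-27980), stub `stub_windowFactsH`: the ZERO MODE is conserved by every `IsPropagator` family — `fcoeff_zero_apply_eq`
# (helper; `--supports … --as helper`; lead-k1l-onelevel-p1 g3)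

The (Z) floors of the window ledger (`z_of_pieces` …ZAssembly p669953, `floor_of_dissipBound` …ZFloor p670193) treat the energy outside the
slow-low frequency set as fully dissipated in one window; the one mode that is NEVER dissipated is `k = 0` (the mean), whose weight in W3-E (i) is
`min(1, rate_0 τ) = 0`.  The assembly therefore needs that the true and coarse window maps do not create mean: THIS FILE proves, for ANY family
`U` with `Torus.IsPropagator T b 𝔸 U` (coercive constant tensor, bounded a.e.-divergence-free carrier) and every weakly divergence-free `y`,
`𝓕(U s t y)(0) = 𝓕(y)(0)` for `0 ≤ s ≤ t ≤ T` (`fcoeff_zero_apply_eq_of_divFree`): the zero mode of a Lions weak solution is constant for a.e.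
time (`IsWeakTensorPassiveVectorOn.ae_mFourierCoeff_zero_eq`), the propagator represents that solution a.e. (`repr`), and weak continuity in `t`
(`continuousOn`, tested against the zero-mode projection of `U s t y − y` itself) carries the identity to every `t`.  Corollaries: the carrier
form along `E.partialSum m` (`fcoeff_zero_apply_eq`), the zero mode of an admissible datum vanishes (`fcoeff_zero_datumLp`), and the zero-mode
projector `P₀` (`exists_zeroModeProj`).  NOT a proof of the stub, of the crux, or of AD; rung F-D1.A0.
-/

set_option linter.dupNamespace false

noncomputable section

namespace Summit.AnomalousDissipation.AnomalousDissipation.Theorems.SolenoidalFractalHomogenisation.LagrangianStep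

open Literature.Analysis Literature.Analysis.FluidPDE Literature.Analysis.FunctionSpaces
open MeasureTheory Set Filter UnitAddTorus
open scoped ENNReal NNReal InnerProductSpace Classical
open OneLevelSplit

/-- The zero-mode projector on `V2`: `𝓕(P₀ y)(k) = 𝓕(y)(0)` at `k = 0` and `0` elsewhere. -/
theorem exists_zeroModeProj : ∃ P₀ : V2 →L[ℝ] V2, ∀ (y : V2) (k : Fin 3 → ℤ),
    mFourierCoeff (EuclideanSpace.complexify ∘ ⇑(P₀ y)) k
      = if k = 0 then mFourierCoeff (EuclideanSpace.complexify ∘ ⇑y) k else 0 := by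
  obtain ⟨P₀, hP₀⟩ := exists_labelProj ({0} : Set (Fin 3 → ℤ)) (fun k => by simp)
  exact ⟨P₀, fun y k => by rw [hP₀]; simp only [Set.mem_singleton_iff]⟩

/-- Pairing with a zero-mode-only vector sees only the zero mode: `⟪v, P₀ v⟫ = ‖𝓕v(0)‖²`. -/
theorem inner_zeroModeProj_self {P₀ : V2 →L[ℝ] V2}
    (hP₀ : ∀ (y : V2) (k : Fin 3 → ℤ), mFourierCoeff (EuclideanSpace.complexify ∘ ⇑(P₀ y)) k
      = if k = 0 then mFourierCoeff (EuclideanSpace.complexify ∘ ⇑y) k else 0) (v : V2) :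
    ⟪v, P₀ v⟫_ℝ = ‖mFourierCoeff (EuclideanSpace.complexify ∘ ⇑v) 0‖ ^ 2 := by
  rw [inner_eq_sum_of_support {0} v (P₀ v) (fun k hk => by
    rw [hP₀]; rw [Finset.mem_singleton] at hk; simp [hk])]
  rw [Finset.sum_singleton, hP₀, if_pos rfl, inner_self_eq_norm_sq_to_K]
  norm_cast

/-- **The zero mode is conserved by every `IsPropagator` family on divergence-free data.**  For `U` with `IsPropagator T b 𝔸 U`
(`NearIso 𝔸 lo hi`, `lo > 0`, bounded a.e.-divergence-free carrier) and weakly divergence-free `y`: `𝓕(U s t y)(0) = 𝓕(y)(0)` for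
`0 ≤ s ≤ t ≤ T`. -/
theorem fcoeff_zero_apply_eq_of_divFree {b : ℝ → UnitAddTorus (Fin 3) → EuclideanSpace ℝ (Fin 3)} {𝔸 : Torus.Visc4 (Fin 3)}
    {lo hi T : ℝ} {U : ℝ → ℝ → (V2 →L[ℝ] V2)} (hU : Torus.IsPropagator T b 𝔸 U) (h𝔸 : Torus.NearIso 𝔸 lo hi) (hlo : 0 < lo)
    (hb : MemLp (Torus.stLift b) ∞ (volume.restrict (Ioo 0 T ×ˢ univ)))
    (hbdiv : ∀ᵐ τ ∂(volume.restrict (Ioo 0 T)), Torus.IsWeaklyDivFree (b τ))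
    {s t : ℝ} (hs : 0 ≤ s) (hst : s ≤ t) (htT : t ≤ T) (y : V2) (hy : Torus.IsWeaklyDivFree ((y : V2) : VF)) :
    mFourierCoeff (EuclideanSpace.complexify ∘ ⇑(U s t y)) 0 = mFourierCoeff (EuclideanSpace.complexify ∘ ⇑y) 0 := by
  rcases eq_or_lt_of_le hst with h | h
  · subst h; rw [hU.self_of_divFree s hs htT y hy]
  have hsT : s < T := lt_of_lt_of_le h htT
  have hφ : MemLp ((y : V2) : VF) 2 volume := Lp.memLp y
  obtain ⟨w, hw⟩ := Torus.exists_windowSol h𝔸 hlo hb hbdiv hs hsT hφ hy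
  have r := hU.repr s hs hsT ((y : V2) : VF) hφ hy w hw
  have hyL : hφ.toLp ((y : V2) : VF) = y := Lp.toLp_coeFn y hφ
  have z := hw.ae_mFourierCoeff_zero_eq (hφ.integrable one_le_two)
  obtain ⟨P₀, hP₀⟩ := exists_zeroModeProj
  set v : V2 := U s t y - y with hv_def
  -- `τ' ↦ ⟪U s (s+τ') y, P₀ v⟫` is continuous on `[0, T − s]` and a.e. equal to the constant `⟪y, P₀ v⟫`
  have hcU : ContinuousOn (fun τ' => ⟪U s (s + τ') y, P₀ v⟫_ℝ) (Icc 0 (T - s)) := by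
    have hc := hU.continuousOn s hs hsT.le y (P₀ v)
    refine (hc.comp (continuousOn_const.add continuousOn_id) fun τ' hτ' => ?_)
    exact ⟨by linarith [hτ'.1], by linarith [hτ'.2]⟩
  have hae : (fun τ' => ⟪U s (s + τ') y, P₀ v⟫_ℝ) =ᵐ[volume.restrict (Icc 0 (T - s))] fun _ => ⟪y, P₀ v⟫_ℝ := by
    rw [Measure.restrict_congr_set Ioo_ae_eq_Icc.symm]
    filter_upwards [r, z] with τ hr hz
    obtain ⟨hm, he⟩ := hr
    rw [hyL] at he
    have hcoe : (EuclideanSpace.complexify ∘ ⇑(U s (s + τ) y)) =ᵐ[volume] (EuclideanSpace.complexify ∘ w τ) := by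
      rw [← he]
      filter_upwards [hm.coeFn_toLp] with x hx
      simp only [Function.comp_apply, hx]
    have h0 : mFourierCoeff (EuclideanSpace.complexify ∘ ⇑(U s (s + τ) y)) 0
        = mFourierCoeff (EuclideanSpace.complexify ∘ ⇑y) 0 := by
      rw [Torus.mFourierCoeff_congr_ae hcoe 0, hz]
    have hdiff : ⟪U s (s + τ) y - y, P₀ v⟫_ℝ = 0 := inner_eq_zero_of_disjoint_fcoeff fun k => by
      by_cases hk : k = 0
      · left; subst hk; rw [fcoeff_sub, h0, sub_self]
      · right; rw [hP₀, if_neg hk]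
    show ⟪U s (s + τ) y, P₀ v⟫_ℝ = ⟪y, P₀ v⟫_ℝ
    rwa [inner_sub_left, sub_eq_zero] at hdiff
  have hts : t - s ∈ Icc 0 (T - s) := ⟨by linarith, by linarith⟩
  have key := Measure.eqOn_Icc_of_ae_eq (volume : Measure ℝ) (sub_pos.2 hsT).ne hae hcU continuousOn_const hts
  simp only at key
  rw [show s + (t - s) = t by ring] at key
  -- `⟪v, P₀ v⟫ = 0`, i.e. `𝓕v(0) = 0`
  have hv0 : ⟪v, P₀ v⟫_ℝ = 0 := by rw [hv_def, inner_sub_left, sub_eq_zero]; exact key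
  have hF0 : mFourierCoeff (EuclideanSpace.complexify ∘ ⇑v) 0 = 0 := by
    have h2 : ‖mFourierCoeff (EuclideanSpace.complexify ∘ ⇑v) 0‖ ^ 2 = 0 := by rw [← inner_zeroModeProj_self hP₀, hv0]
    exact norm_eq_zero.1 (pow_eq_zero_iff two_ne_zero |>.1 h2)
  rw [hv_def, fcoeff_sub] at hF0
  exact sub_eq_zero.1 hF0

/-- **Carrier form.**  Along an `L`-permissible regular carrier the window maps `Um s t` of any coercive constant tensor conserve the mean of
divergence-free data: `𝓕(Um s t y)(0) = 𝓕(y)(0)`, `0 ≤ s ≤ t ≤ 1`. -/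
theorem fcoeff_zero_apply_eq {k : ℕ} (E : LatticeShear.LagrangianLatticeCarrier k) (hR : E.Regular) (m : ℕ)
    {𝔸 : Torus.Visc4 (Fin 3)} {lo hi : ℝ} (hlo : 0 < lo) (hNI : Torus.NearIso 𝔸 lo hi)
    {Um : ℝ → ℝ → (V2 →L[ℝ] V2)} (hUm : Torus.IsPropagator 1 (E.partialSum m) 𝔸 Um)
    {s t : ℝ} (hs : 0 ≤ s) (hst : s ≤ t) (ht : t ≤ 1) (y : V2) (hy : Torus.IsWeaklyDivFree ((y : V2) : VF)) :
    mFourierCoeff (EuclideanSpace.complexify ∘ ⇑(Um s t y)) 0 = mFourierCoeff (EuclideanSpace.complexify ∘ ⇑y) 0 := by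
  have hc : ∀ i < m, Continuous (Function.uncurry (E.b (i + 1))) := fun i _ => hR.levelRegular.continuous_uncurry_b i
  have hd : ∀ i < m, ∀ t, Torus.IsWeaklyDivFree (E.b (i + 1) t) := fun i _ t => hR.levelRegular.isWeaklyDivFree_b i t
  have hb : MemLp (Torus.stLift (E.partialSum m)) ∞
      (volume.restrict (Ioo 0 1 ×ˢ (univ : Set (EuclideanSpace ℝ (Fin 3))))) :=
    LagrangianRenormalisationStep.memLp_top_stLift_of_continuous
      (LagrangianRenormalisationStep.continuous_uncurry_partialSum E m hc) 1
  have hbdiv : ∀ᵐ t ∂(volume.restrict (Ioo (0 : ℝ) 1)), Torus.IsWeaklyDivFree (E.partialSum m t) :=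
    ae_of_all _ fun t => LagrangianRenormalisationStep.isWeaklyDivFree_partialSum E m hc hd t
  exact fcoeff_zero_apply_eq_of_divFree hUm hNI hlo hb hbdiv hs hst ht y hy

/-- The zero mode of an admissible datum (mean zero) vanishes in `V2`. -/
theorem fcoeff_zero_datumLp (w₁ : VF) (hw₁ : IsDatum w₁) :
    mFourierCoeff (EuclideanSpace.complexify ∘ ⇑(datumLp w₁ hw₁)) 0 = 0 := by
  have hae : (EuclideanSpace.complexify ∘ ⇑(datumLp w₁ hw₁)) =ᵐ[volume] (EuclideanSpace.complexify ∘ w₁) := by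
    filter_upwards [coeFn_datumLp w₁ hw₁] with x hx
    simp only [Function.comp_apply, hx]
  rw [Torus.mFourierCoeff_congr_ae hae 0]
  exact Torus.mFourierCoeff_complexify_zero_of_hasZeroMean
    ((RealisedQuasiStaticCellLaw.memLp_two_of_memSobolev_one_complexify hw₁.1).integrable one_le_two) hw₁.2.1

end Summit.AnomalousDissipation.AnomalousDissipation.Theorems.SolenoidalFractalHomogenisation.LagrangianStep
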